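import Literature.RepresentationTheory.TwistedCoinvariantsTypePeriodicity
import HarnessLib

/-!
# A type set closed under translation by `λ` is `λ`-PERIODIC: one-sided translation invariance of the types of a representation
# of a compact commutative group is two-sided (finitely many characters at each level)

Topic `RepresentationTheory`; namespace `Literature.RepresentationTheory.TwistedCoinv` (sequel of ★ `TwistedCoinvariants`; companion of ★
`TwistedCoinvariantsTypePeriodicity`, whose PERIODICITY hypothesis «`Coinv ρ ξ ≠ 0 ↔ Coinv ρ (ξ η) ≠ 0` for every open-kernel `ξ`» it produces
from the ONE-SIDED version).  KERNEL ONLY: theorems; no definition, no named fact, no `sorry`.  Cell hodgecm-mathlib, fan B rung B-IV;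
`--supports stmt-HodgeConjecture-24832`.

For a representation `ρ` of a COMPACT group `K` with commuting elements (no smoothness needed) and a character `λ` with OPEN kernel:

* `nontrivial_coinv_of_nontrivial_coinv_mul` — if the type set `{ξ : ker ξ open, Coinv_ξ(ρ) ≠ 0}` is closed under `ξ ↦ ξ·λ`, it is closed
  under `ξ ↦ ξ·λ⁻¹`: for `ξ` with `Coinv_{ξλ}(ρ) ≠ 0` also `Coinv_ξ(ρ) ≠ 0`.  Proof: the characters trivial on the open subgroup
  `K₀ = ker ξ ∩ ker λ` are FINITELY many (they factor through the finite group `K/K₀`; Mathlib's `Finite (G →* ℂˣ)`), translation by `λ`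
  preserves them and is injective, so on the finite set of those with non-zero coinvariants it is a bijection;
* `nontrivial_coinv_iff_mul_of_forall` — the resulting PERIODICITY `Coinv_ξ(ρ) ≠ 0 ↔ Coinv_{ξλ}(ρ) ≠ 0` for every open-kernel `ξ` (the
  hypothesis `hper` of ★ `trace_fixedPoints_eq_zero_of_coinv_periodic_of_le_ker`, and of the rank `1 × 1` non-periodicity `hNP` of ★
  `RankOneThetaLiftNonPeriodicOfCharacter`).

This is the counting step of the see-saw argument on the anisotropic plane ([Liu2021, Lem. D.1 (1)], n = 2): «the types of `ω_{s₁}` avoid a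
translate of their complement» ⟹ «the type set is periodic» ⟹ (non-periodicity, [MoeglinVignerasWaldspurger1987, Chap. 3 §IV.4]) the period is
trivial.  HC_CM is proved only modulo the printed citations — the 2 remaining named inputs (hLiu418 = stmt-HodgeConjecture-24832, h413 = 24833) —
until rung 0 closes; count-neutral.

## References
* [BernsteinZelevinsky1976] I. N. Bernstein, A. V. Zelevinsky, Russian Math. Surveys 31 (1976), §2.1–2.3 (types of smooth representations of
  compact totally disconnected groups; characters trivial on an open subgroup).
* [Serre1977] J.-P. Serre, *Linear representations of finite groups*, GTM 42, §2.1 Prop. 1, §3.1 (characters of a finite abelian group).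
* [MoeglinVignerasWaldspurger1987] LNM 1291 (1987), Chap. 3 §IV.4 (the rank-one dichotomy this feeds).
-/

set_option autoImplicit false

noncomputable section

namespace Literature.RepresentationTheory.TwistedCoinv

section Compact

variable {K : Type*} [Group K] [TopologicalSpace K] [IsTopologicalGroup K] [CompactSpace K]
  {S : Type*} [AddCommGroup S] [Module ℂ S] (ρ : Representation ℂ K S)

omit [TopologicalSpace K] [IsTopologicalGroup K] [CompactSpace K] in
/-- If the elements of `K` commute, every subgroup is normal. (Bookkeeping.) [folklore] -/
private theorem normal_of_comm'' (hcomm : ∀ a b : K, a * b = b * a) (K₀ : Subgroup K) : K₀.Normal :=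
  ⟨fun n hn g => by rwa [hcomm g n, mul_inv_cancel_right]⟩

omit [TopologicalSpace K] [IsTopologicalGroup K] [CompactSpace K] in
/-- **Finitely many characters at each level**: the characters of `K` trivial on a normal subgroup `K₀` of finite index form a finite set
(they factor through the finite group `K/K₀`). [cite: Serre1977, §2.1 Prop. 1; §3.1] -/
theorem finite_subtype_le_ker (K₀ : Subgroup K) [K₀.Normal] [Finite (K ⧸ K₀)] :
    Finite {η : K →* ℂˣ // K₀ ≤ η.ker} := by
  refine Finite.of_injective (fun η : {η : K →* ℂˣ // K₀ ≤ η.ker} => QuotientGroup.lift K₀ η.1 η.2) fun η η' h => ?_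
  apply Subtype.ext
  ext k
  have := congrArg (fun φ : K ⧸ K₀ →* ℂˣ => φ (k : K ⧸ K₀)) h
  simpa only [QuotientGroup.lift_mk] using congrArg (fun u : ℂˣ => (u : ℂ)) this

/-- **One-sided translation invariance of the type set is two-sided.**  `K` compact with commuting elements, `ρ` any representation of `K` on a
complex vector space, `λ` a character with OPEN kernel.  If for every open-kernel `ξ` with `Coinv_ξ(ρ) ≠ 0` also `Coinv_{ξ·λ}(ρ) ≠ 0`, then for every
open-kernel `ξ` with `Coinv_{ξ·λ}(ρ) ≠ 0` also `Coinv_ξ(ρ) ≠ 0` (translation by `λ` is an injection of the FINITE set of types trivial on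
`ker ξ ∩ ker λ` into itself, hence onto). [cite: BernsteinZelevinsky1976, §2.3] [cite: Serre1977, §3.1] -/
theorem nontrivial_coinv_of_nontrivial_coinv_mul (hcomm : ∀ a b : K, a * b = b * a) (lam : K →* ℂˣ)
    (hlam : IsOpen (lam.ker : Set K))
    (h : ∀ ξ : K →* ℂˣ, IsOpen (ξ.ker : Set K) → Nontrivial (Coinv ρ ξ) → Nontrivial (Coinv ρ (ξ * lam)))
    (ξ : K →* ℂˣ) (hξ : IsOpen (ξ.ker : Set K)) (hξl : Nontrivial (Coinv ρ (ξ * lam))) :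
    Nontrivial (Coinv ρ ξ) := by
  -- the level `K₀ = ker ξ ∩ ker λ`: open, normal, finite index
  set K₀ : Subgroup K := ξ.ker ⊓ lam.ker with hK₀
  have hK₀o : IsOpen (K₀ : Set K) := hξ.inter hlam
  haveI : K₀.Normal := normal_of_comm'' hcomm K₀
  haveI : Finite (K ⧸ K₀) := Subgroup.quotient_finite_of_isOpen K₀ hK₀o
  -- the finite set `T` of characters trivial on `K₀` with non-zero coinvariants
  let T : Type _ := {η : K →* ℂˣ // K₀ ≤ η.ker ∧ Nontrivial (Coinv ρ η)}
  haveI : Finite {η : K →* ℂˣ // K₀ ≤ η.ker} := finite_subtype_le_ker (K := K) K₀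
  haveI : Finite T :=
    Finite.of_injective (fun η : T => (⟨η.1, η.2.1⟩ : {η : K →* ℂˣ // K₀ ≤ η.ker})) fun a b hab =>
      Subtype.ext (congrArg (fun x : {η : K →* ℂˣ // K₀ ≤ η.ker} => x.1) hab)
  -- translation by `λ` maps `T` into `T` (the one-sided hypothesis) …
  have hmem : ∀ η : T, K₀ ≤ (η.1 * lam).ker ∧ Nontrivial (Coinv ρ (η.1 * lam)) := by
    intro η
    have hle : K₀ ≤ (η.1 * lam).ker := fun k hk => by
      rw [MonoidHom.mem_ker, MonoidHom.mul_apply, η.2.1 hk, (Subgroup.mem_inf.1 hk).2, one_mul]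
    exact ⟨hle, h η.1 (Subgroup.isOpen_mono η.2.1 hK₀o) η.2.2⟩
  let f : T → T := fun η => ⟨η.1 * lam, hmem η⟩
  -- … injectively, hence ONTO (finite set)
  have hinj : Function.Injective f := fun a b hab => by
    apply Subtype.ext
    have := congrArg Subtype.val hab
    exact mul_right_cancel this
  have hsurj : Function.Surjective f := Finite.surjective_of_injective hinj
  -- `ξ·λ ∈ T`, so it is `η·λ` for some `η ∈ T`, and `η = ξ`
  have hξK₀ : K₀ ≤ (ξ * lam).ker := fun k hk => by
    rw [MonoidHom.mem_ker, MonoidHom.mul_apply, (Subgroup.mem_inf.1 hk).1, (Subgroup.mem_inf.1 hk).2, one_mul]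
  obtain ⟨η, hη⟩ := hsurj ⟨ξ * lam, hξK₀, hξl⟩
  have hηξ : η.1 = ξ := mul_right_cancel (congrArg Subtype.val hη)
  rw [← hηξ]
  exact η.2.2

/-- **Periodicity from one-sided invariance**: under the hypotheses of `nontrivial_coinv_of_nontrivial_coinv_mul`, for every open-kernel `ξ`,
`Coinv_ξ(ρ) ≠ 0 ↔ Coinv_{ξ·λ}(ρ) ≠ 0` — the type set is `λ`-PERIODIC (the shape consumed by ★ `trace_fixedPoints_eq_zero_of_coinv_periodic_of_le_ker`
and by the rank `1 × 1` non-periodicity). [cite: BernsteinZelevinsky1976, §2.3] [cite: MoeglinVignerasWaldspurger1987, Chap. 3 §IV.4] -/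
theorem nontrivial_coinv_iff_mul_of_forall (hcomm : ∀ a b : K, a * b = b * a) (lam : K →* ℂˣ)
    (hlam : IsOpen (lam.ker : Set K))
    (h : ∀ ξ : K →* ℂˣ, IsOpen (ξ.ker : Set K) → Nontrivial (Coinv ρ ξ) → Nontrivial (Coinv ρ (ξ * lam)))
    (ξ : K →* ℂˣ) (hξ : IsOpen (ξ.ker : Set K)) :
    Nontrivial (Coinv ρ ξ) ↔ Nontrivial (Coinv ρ (ξ * lam)) :=
  ⟨h ξ hξ, nontrivial_coinv_of_nontrivial_coinv_mul ρ hcomm lam hlam h ξ hξ⟩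

end Compact

end Literature.RepresentationTheory.TwistedCoinv

end
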